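import Summits.Parity.GeneralizedHardyLittlewood.Theorems.GreenTaoLevelTwoGITwoCyclicInversePhaseReplace

/-!
# Route `GreenTaoLevelTwo`, crux `GITwo` (stmt-Parity-21275), line `birth`, stub `stub_cyclicInverse`:
# GT08a §9 Step 3 — replacing `e(−μ(h)x)` by `e(M(x)x)` inside the translated family

Fifty-third helper file toward the XL stub `stub_cyclicInverse` (B. Green, T. Tao, *An inverse
theorem for the Gowers `U³(G)` norm*, arXiv:math/0503014, Thm. 68 = PEMS 51 (2008) Thm. 12.8).
Block C13, §9 Step 3, display "Thus we have `𝔼_y |𝔼_{x,h∈B₄} b(h,y) b(x+h,y) f̄(x+y) e(Mx·x)| ≥ …`":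
inside the family produced by `exists_translate_family_ge` (`…TranslateAverage`) the phase
`e(−μ(h)x)` is replaced termwise by `conj e(M(x+h)(x+h)) · e(M(h)h) · e(M(x)x)` (`M = c·μ`, `2c = 1`)
at cost `2π θ` per term, where `θ` bounds `‖{x,h}_M‖` on `B₄` (from `symmetry_half`); the two
extra phases are absorbed into the weights of `h` and of `x + h`.

* `sum_norm_phase_replaced_ge` — `K − 2πθ N #B₄² ≤ Σ_y |Σ_{h∈B₄} b'(y,h) Σ_{x∈B₄} c₂'(y,x+h) (c₃(x+y) e(M(x)x))|`
  with explicit `1`-bounded `b', c₂'`.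

References: [GreenTao2008U3Inverse] arXiv:math/0503014, §9 Step 3.
-/

noncomputable section

namespace Summit.Parity.GeneralizedHardyLittlewood.GreenTaoLevelTwoGITwoCyclicInverse

open Finset ZMod
open scoped ComplexConjugate

open Literature.NumberTheory.Sieve

variable {N : ℕ} [NeZero N]

/-- **GT08a §9 Step 3, phase replacement inside the family.**  Let `B₄ ⊆ ℤ/Nℤ`, `2c = 1`,
`μ` additive on pairs from `B₄`, `‖toAddCircle(cμ(x)h − cμ(h)x)‖ ≤ θ` for `x, h ∈ B₄`, and weights
`‖b‖, ‖c₂‖ ≤ 1`.  If `K ≤ Σ_y |Σ_{h∈B₄} b y h Σ_{x∈B₄} c₂(x+y+h) c₃(x+y) e(−μ(h)x)|` then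
`K − 2πθ N #B₄² · sup|c₃| …` — precisely, with `‖c₃‖ ≤ 1`:
`K − 2πθ N #B₄² ≤ Σ_y |Σ_{h∈B₄} (b y h · e(cμ(h)h)) Σ_{x∈B₄} (c₂(x+y+h) conj e(cμ(x+h)(x+h))) (c₃(x+y) e(cμ(x)x))|`.
[cite: GreenTao2008U3Inverse, §9 Step 3] -/
theorem sum_norm_phase_replaced_ge (B₄ : Finset (ZMod N)) {c : ZMod N} (hc : 2 * c = 1)
    (μ : ZMod N → ZMod N) (hadd : ∀ x ∈ B₄, ∀ h ∈ B₄, μ (x + h) = μ x + μ h) {θ : ℝ}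
    (hθ : ∀ x ∈ B₄, ∀ h ∈ B₄, ‖ZMod.toAddCircle (c * μ x * h - c * μ h * x)‖ ≤ θ)
    (b : ZMod N → ZMod N → ℂ) (c₂ c₃ : ZMod N → ℂ) (hb : ∀ y h, ‖b y h‖ ≤ 1)
    (hc₂ : ∀ v, ‖c₂ v‖ ≤ 1) (hc₃ : ∀ v, ‖c₃ v‖ ≤ 1) {K : ℝ}
    (hK : K ≤ ∑ y : ZMod N, ‖∑ h ∈ B₄, b y h *
        ∑ x ∈ B₄, c₂ (x + y + h) * c₃ (x + y) * stdAddChar (-(μ h * x))‖) :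
    K - 2 * Real.pi * θ * N * (#B₄ : ℝ) ^ 2 ≤
      ∑ y : ZMod N, ‖∑ h ∈ B₄, (b y h * stdAddChar (c * μ h * h)) *
        ∑ x ∈ B₄, (c₂ (x + y + h) * conj (ZMod.stdAddChar (c * μ (x + h) * (x + h)) : ℂ)) *
          (c₃ (x + y) * stdAddChar (c * μ x * x))‖ := by
  classical
  -- termwise replacement bound
  have hterm : ∀ y : ZMod N, ∀ h ∈ B₄, ∀ x ∈ B₄,
      ‖b y h * (c₂ (x + y + h) * c₃ (x + y) * stdAddChar (-(μ h * x))) -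
        (b y h * stdAddChar (c * μ h * h)) *
          ((c₂ (x + y + h) * conj (ZMod.stdAddChar (c * μ (x + h) * (x + h)) : ℂ)) *
            (c₃ (x + y) * stdAddChar (c * μ x * x)))‖ ≤ 2 * Real.pi * θ := by
    intro y h hh x hx
    have hrepl := norm_stdAddChar_neg_mu_sub_le hc μ (hadd x hx h hh)
    have hfac : b y h * (c₂ (x + y + h) * c₃ (x + y) * stdAddChar (-(μ h * x))) -
        (b y h * stdAddChar (c * μ h * h)) *
          ((c₂ (x + y + h) * conj (ZMod.stdAddChar (c * μ (x + h) * (x + h)) : ℂ)) *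
            (c₃ (x + y) * stdAddChar (c * μ x * x))) =
        (b y h * c₂ (x + y + h) * c₃ (x + y)) *
          ((stdAddChar (-(μ h * x)) : ℂ) -
            conj (ZMod.stdAddChar (c * μ (x + h) * (x + h)) : ℂ) * stdAddChar (c * μ h * h) *
              stdAddChar (c * μ x * x)) := by ring
    rw [hfac, norm_mul]
    have hw : ‖b y h * c₂ (x + y + h) * c₃ (x + y)‖ ≤ 1 := by
      rw [norm_mul, norm_mul]
      calc ‖b y h‖ * ‖c₂ (x + y + h)‖ * ‖c₃ (x + y)‖ ≤ 1 * 1 * 1 :=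
            mul_le_mul (mul_le_mul (hb y h) (hc₂ _) (norm_nonneg _) zero_le_one) (hc₃ _)
              (norm_nonneg _) (by positivity)
        _ = 1 := by ring
    calc ‖b y h * c₂ (x + y + h) * c₃ (x + y)‖ * _ ≤ 1 * (2 * Real.pi * θ) :=
          mul_le_mul hw (hrepl.trans (mul_le_mul_of_nonneg_left (hθ x hx h hh) (by positivity)))
            (norm_nonneg _) zero_le_one
      _ = 2 * Real.pi * θ := one_mul _
  -- difference of the two double sums, for each `y`
  have hdiff : ∀ y : ZMod N,
      ‖(∑ h ∈ B₄, b y h * ∑ x ∈ B₄, c₂ (x + y + h) * c₃ (x + y) * stdAddChar (-(μ h * x))) -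
        ∑ h ∈ B₄, (b y h * stdAddChar (c * μ h * h)) *
          ∑ x ∈ B₄, (c₂ (x + y + h) * conj (ZMod.stdAddChar (c * μ (x + h) * (x + h)) : ℂ)) *
            (c₃ (x + y) * stdAddChar (c * μ x * x))‖ ≤ 2 * Real.pi * θ * (#B₄ : ℝ) ^ 2 := by
    intro y
    rw [← sum_sub_distrib]
    refine (norm_sum_le _ _).trans ?_
    have : ∀ h ∈ B₄, ‖b y h * ∑ x ∈ B₄, c₂ (x + y + h) * c₃ (x + y) * stdAddChar (-(μ h * x)) -
        (b y h * stdAddChar (c * μ h * h)) *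
          ∑ x ∈ B₄, (c₂ (x + y + h) * conj (ZMod.stdAddChar (c * μ (x + h) * (x + h)) : ℂ)) *
            (c₃ (x + y) * stdAddChar (c * μ x * x))‖ ≤ #B₄ * (2 * Real.pi * θ) := by
      intro h hh
      rw [mul_sum, mul_sum, ← sum_sub_distrib]
      refine (norm_sum_le _ _).trans ?_
      calc ∑ x ∈ B₄, _ ≤ ∑ x ∈ B₄, 2 * Real.pi * θ := sum_le_sum fun x hx => hterm y h hh x hx
        _ = #B₄ * (2 * Real.pi * θ) := by rw [sum_const, nsmul_eq_mul]
    calc ∑ h ∈ B₄, _ ≤ ∑ h ∈ B₄, (#B₄ : ℝ) * (2 * Real.pi * θ) := sum_le_sum this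
      _ = 2 * Real.pi * θ * (#B₄ : ℝ) ^ 2 := by rw [sum_const, nsmul_eq_mul]; ring
  -- sum over `y`
  have hsum : ∑ y : ZMod N, ‖∑ h ∈ B₄, b y h *
      ∑ x ∈ B₄, c₂ (x + y + h) * c₃ (x + y) * stdAddChar (-(μ h * x))‖ ≤
      ∑ y : ZMod N, (‖∑ h ∈ B₄, (b y h * stdAddChar (c * μ h * h)) *
        ∑ x ∈ B₄, (c₂ (x + y + h) * conj (ZMod.stdAddChar (c * μ (x + h) * (x + h)) : ℂ)) *
          (c₃ (x + y) * stdAddChar (c * μ x * x))‖ + 2 * Real.pi * θ * (#B₄ : ℝ) ^ 2) :=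
    sum_le_sum fun y _ => by
      have := norm_sub_norm_le (∑ h ∈ B₄, b y h *
        ∑ x ∈ B₄, c₂ (x + y + h) * c₃ (x + y) * stdAddChar (-(μ h * x)))
        (∑ h ∈ B₄, (b y h * stdAddChar (c * μ h * h)) *
          ∑ x ∈ B₄, (c₂ (x + y + h) * conj (ZMod.stdAddChar (c * μ (x + h) * (x + h)) : ℂ)) *
            (c₃ (x + y) * stdAddChar (c * μ x * x)))
      linarith [hdiff y]
  rw [sum_add_distrib, sum_const, card_univ, ZMod.card, nsmul_eq_mul] at hsum
  linarith

end Summit.Parity.GeneralizedHardyLittlewood.GreenTaoLevelTwoGITwoCyclicInverse
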